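/-
Origin: expansion seat `planner-pub-hodgecm-qw8-g11-0`, handover #15 SPLIT PART 2/2 = REPLACE tree `HodgeCM/Model/Toy/LefTypes.lean` 794160ff (488 l.) by md5 f2d9b59c7d4a4d004327e71d216eb998 (264 l.): keeps the module name + module docstring, its earlier sections moved verbatim to rows #14..#14 (LefTypesBasic); ONE rewrite: `import Qw8g11.LefTypesBasic` -> `import HodgeCM.Model.Toy.LefTypesBasic` (row #14); union of the parts' comment-stripped code = the tree f (`HOME/pub-hodgecm-qw8-g11/lean/Qw8g11/LefTypes.lean`, md5 f2d9b59c, 264 lines);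
landed by the packager successor (mc-unitary-1-g3, gen-8 kit) in gate run 32 REPLACES the earlier landed copy of `HodgeCM/Model/Toy/LefTypes.lean` (import ^import Qw8g11\.LefTypesBasic[ \t]*$→import HodgeCM.Model.Toy.LefTypesBasic ×1).
-/
-- HANDOVER (planner-pub-hodgecm-qw8-g11-0, unit pub-hodgecm-qw8-g11): SPLIT PART 2/2 = REPLACEMENT of the installed
-- `HodgeCM.Model.Toy.LefTypes` (md5 794160ff, 488 l.): its ll. 282–483 (balanced index sets + wedge basis, multiplicativity,
-- naturality, CM objects) verbatim + docstrings (module docstring moved after the imports as `/-! -/`); ll. 39–281 moved to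
-- `LefTypesBasic`; at landing rewrite `import Qw8g11.LefTypesBasic` ↦ `import HodgeCM.Model.Toy.LefTypesBasic` (lands AFTER it).
/-
Copyright: HodgeCMPerL expansion cell, seat pub-hodgecm-qw8-g5 ([QW8] §2.5 lineage, gen 5).
-/
import Summits.HodgeConjecture.HodgeCM.Model.Toy.LefTypesBasic

/-!
# Galois types of eigen-indices and the balanced-type spans (engine of the cup-closed separating model)

(Split for the 400-line cap: `Qbar`, `Gam`, the Galois action on eigen-indices, `typ`, `coefQ` and the link lemma, the type
counts `tcnt`/`Bal` and the spans `balSpan`/`unbSpan` are now the module `HodgeCM.Model.Toy.LefTypesBasic`, imported here;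
the rest of the file is unchanged.)

For an object `X` of the exterior toy universe (`HodgeCM.Model.Toy`), every eigen-index `s = (i, τ)`
(`τ : F_i →+* ℂ` an embedding of the atom field) has a **Galois type**
`typ s = {γ ∈ Aut_ℚ(ℚ̄) | γ ∘ τ ∈ Φ_i} ⊆ Γ`, `ℚ̄ = algebraicClosure ℚ ℂ`, `Γ = (ℚ̄ ≃ₐ[ℚ] ℚ̄)`.
The **link lemma** (`typ_eq_of_coefQ_ne_zero`): if the eigen-coordinate of a Hodge `ℚ`-linear map
`φ_ℂ (e_t)` at `e_s` is nonzero then `typ s = typ t` — the coordinate is an algebraic number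
`ĉ_{s,t}(φ) ∈ ℚ̄` (explicit trace-dual-basis formula `coefQ`), Galois-equivariant
(`coefQ_gact`), and the Hodge condition reads `ĉ ≠ 0 ⇒ (s holomorphic ↔ t holomorphic)`.
An index map `g : Fin k → Idx X` is **balanced** when for every `T ⊆ Γ` the number of entries of type
`T` equals the number of entries of type `Tᶜ`; `balSpan X k` / `unbSpan X k` are the spans of the
balanced / unbalanced eigen-monomials: complementary (`isCompl_balSpan_unbSpan`), multiplicative
(`wedge_mem_balSpan`, `wedge_mem_unbSpan_of_bal`) and natural under pull-backs along Hodge maps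
(`balSpan_map_le`, `unbSpan_map_le`).  No Hodge datum is involved: this file is pure
(multi)linear algebra over the eigenbasis of `HodgeCM.Model.Toy.EigenBasis`.
-/

noncomputable section

set_option backward.isDefEq.respectTransparency false

open TensorProduct exteriorPower Module

namespace HodgeCM.Toy

namespace Obj

variable (X : Obj) {Y : Obj}

/-! ### Balanced index SETS and the wedge basis -/

/-- number of elements of a given Galois type in a finite set of indices -/
def fcnt (S : Finset X.Idx) (T : Set Gam) : ℕ :=
  (@Finset.filter _ (fun s => X.typ s = T) (fun _ => Classical.propDecidable _) S).card

/-- `fcnt S T` as a `Finset.filter` cardinality, for any decidability instance -/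
lemma fcnt_eq_card_filter (S : Finset X.Idx) (T : Set Gam) [DecidablePred fun s : X.Idx => X.typ s = T] :
    X.fcnt S T = (S.filter fun s => X.typ s = T).card := by
  unfold fcnt
  congr 1
  ext s
  simp only [Finset.mem_filter]

/-- balanced index sets -/
def BalS (S : Finset X.Idx) : Prop := ∀ T : Set Gam, X.fcnt S T = X.fcnt S Tᶜ

/-- for an injective index map, the type counts of its image SET are those of the map -/
lemma fcnt_image {k : ℕ} (g : Fin k → X.Idx) (hg : Function.Injective g) (T : Set Gam) :
    X.fcnt (Finset.univ.image g) T = X.tcnt g T := by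
  classical
  rw [tcnt_eq_card_filter, ← Finset.card_image_of_injective (Finset.univ.filter fun j => X.typ (g j) = T) hg,
    fcnt_eq_card_filter]
  congr 1
  ext s
  simp only [Finset.mem_filter, Finset.mem_image, Finset.mem_univ, true_and]
  constructor
  · rintro ⟨⟨j, rfl⟩, h⟩; exact ⟨j, h, rfl⟩
  · rintro ⟨j, h, rfl⟩; exact ⟨⟨j, rfl⟩, h⟩

/-- an injective index map is balanced iff its image set is balanced -/
lemma bal_iff_balS {k : ℕ} (g : Fin k → X.Idx) (hg : Function.Injective g) :
    X.Bal g ↔ X.BalS (Finset.univ.image g) := by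
  simp only [Bal, BalS, fcnt_image _ g hg]

/-- `balSpan k` is contained in the span of the wedge-basis vectors `e_S`, `S` a balanced `k`-set of
indices -/
lemma balSpan_le_span (k : ℕ) :
    X.balSpan k ≤ Submodule.span ℂ ((X.eB.exteriorPower k) '' {S | X.BalS S.val}) := by
  rw [balSpan, Submodule.span_le]
  rintro _ ⟨g, hg, rfl⟩
  by_cases hinj : Function.Injective g
  · obtain ⟨σ, hσ⟩ := X.mono_eq_sign_smul_basis g hinj
    rw [hσ]
    refine zsmul_units_mem _ _ (Submodule.subset_span ⟨X.imFin g hinj, ?_, rfl⟩)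
    show X.BalS (Finset.univ.image g)
    rwa [← bal_iff_balS _ g hinj]
  · rw [X.mono_eq_zero_of_not_injective hinj]
    exact zero_mem _

/-- `unbSpan k` is contained in the span of the wedge-basis vectors `e_S`, `S` an unbalanced `k`-set
of indices -/
lemma unbSpan_le_span (k : ℕ) :
    X.unbSpan k ≤ Submodule.span ℂ ((X.eB.exteriorPower k) '' {S | ¬ X.BalS S.val}) := by
  rw [unbSpan, Submodule.span_le]
  rintro _ ⟨g, hg, rfl⟩
  by_cases hinj : Function.Injective g
  · obtain ⟨σ, hσ⟩ := X.mono_eq_sign_smul_basis g hinj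
    rw [hσ]
    refine zsmul_units_mem _ _ (Submodule.subset_span ⟨X.imFin g hinj, ?_, rfl⟩)
    show ¬ X.BalS (Finset.univ.image g)
    rwa [← bal_iff_balS _ g hinj]
  · rw [X.mono_eq_zero_of_not_injective hinj]
    exact zero_mem _

/-- `balSpan k` and `unbSpan k` are disjoint (they sit in spans of disjoint parts of the wedge
basis) -/
lemma disjoint_balSpan_unbSpan (k : ℕ) : Disjoint (X.balSpan k) (X.unbSpan k) := by
  refine Disjoint.mono (X.balSpan_le_span k) (X.unbSpan_le_span k) ?_
  apply (X.eB.exteriorPower k).linearIndependent.disjoint_span_image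
  rw [Set.disjoint_iff]
  rintro S ⟨h1, h2⟩
  exact h2 h1

/-- **`balSpan k` and `unbSpan k` are complementary.** -/
theorem isCompl_balSpan_unbSpan (k : ℕ) : IsCompl (X.balSpan k) (X.unbSpan k) :=
  ⟨X.disjoint_balSpan_unbSpan k, codisjoint_iff.mpr (X.balSpan_sup_unbSpan k)⟩

/-- the balanced part of degree `0` is everything (the empty monomial is balanced) -/
lemma unbSpan_zero : X.unbSpan 0 = ⊥ := by
  rw [unbSpan, Submodule.span_eq_bot]
  rintro _ ⟨g, hg, rfl⟩
  exfalso
  apply hg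
  intro T
  classical
  rw [tcnt_eq_card_filter, tcnt_eq_card_filter]
  simp

/-! ### Multiplicativity -/

/-- **multiplicativity**: the wedge of two balanced classes is balanced -/
theorem wedge_mem_balSpan (k l : ℕ) {a : ⋀[ℂ]^k X.LC} {b : ⋀[ℂ]^l X.LC}
    (ha : a ∈ X.balSpan k) (hb : b ∈ X.balSpan l) :
    wedge ℂ X.LC k l a b ∈ X.balSpan (k + l) := by
  have h := Submodule.apply_mem_map₂ (wedge ℂ X.LC k l) ha hb
  rw [balSpan, balSpan, Submodule.map₂_span_span] at h
  refine (Submodule.span_le.mpr ?_) h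
  rintro _ ⟨x, ⟨g, hg, rfl⟩, y, ⟨g', hg', rfl⟩, rfl⟩
  show wedge ℂ X.LC k l (X.mono k g) (X.mono l g') ∈ X.balSpan (k + l)
  rw [wedge_mono]
  exact X.mono_mem_balSpan (X.bal_append hg hg')

/-- the wedge of an unbalanced class with a balanced class is unbalanced -/
theorem wedge_mem_unbSpan (k l : ℕ) {a : ⋀[ℂ]^k X.LC} {b : ⋀[ℂ]^l X.LC}
    (ha : a ∈ X.unbSpan k) (hb : b ∈ X.balSpan l) :
    wedge ℂ X.LC k l a b ∈ X.unbSpan (k + l) := by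
  have h := Submodule.apply_mem_map₂ (wedge ℂ X.LC k l) ha hb
  rw [unbSpan, balSpan, Submodule.map₂_span_span] at h
  refine (Submodule.span_le.mpr ?_) h
  rintro _ ⟨x, ⟨g, hg, rfl⟩, y, ⟨g', hg', rfl⟩, rfl⟩
  show wedge ℂ X.LC k l (X.mono k g) (X.mono l g') ∈ X.unbSpan (k + l)
  rw [wedge_mono]
  exact X.mono_mem_unbSpan (X.not_bal_append hg hg')

/-! ### Naturality under Hodge maps (the link lemma at work) -/

variable {X}

/-- **pull-back of an eigen-monomial**: a combination of eigen-monomials with the SAME type counts -/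
theorem map_mono_mem_span_tcnt (f : Hom X Y) (k : ℕ) (g : Fin k → Y.Idx) :
    exteriorPower.map k (f.lin.baseChange ℂ) (Y.mono k g) ∈
      Submodule.span ℂ {x | ∃ r : Fin k → X.Idx, (∀ T, X.tcnt r T = Y.tcnt g T) ∧ x = X.mono k r} := by
  classical
  rw [map_mono]
  have hw : (fun j => f.lin.baseChange ℂ (Y.eB (g j)))
      = fun j => ∑ s, (X.eB.repr (f.lin.baseChange ℂ (Y.eB (g j))) s) • X.eB s :=
    funext fun j => (X.eB.sum_repr _).symm
  have hsum := MultilinearMap.map_sum (ιMulti ℂ k (M := X.LC)).toMultilinearMap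
    (fun j s => (X.eB.repr (f.lin.baseChange ℂ (Y.eB (g j))) s) • X.eB s)
  simp only [AlternatingMap.coe_multilinearMap] at hsum
  rw [hw, hsum]
  refine Submodule.sum_mem _ fun r _ => ?_
  rw [AlternatingMap.map_smul_univ]
  by_cases hc : (∏ j, X.eB.repr (f.lin.baseChange ℂ (Y.eB (g j))) (r j)) = 0
  · rw [hc, zero_smul]
    exact zero_mem _
  · refine Submodule.smul_mem _ _ (Submodule.subset_span ⟨r, fun T => tcnt_congr (fun j => ?_) T, rfl⟩)
    have h1 := Finset.prod_ne_zero_iff.mp hc j (Finset.mem_univ j)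
    rw [repr_baseChange_eB] at h1
    exact typ_eq_of_coefQ_ne_zero f fun h0 => h1 (by rw [h0]; rfl)

/-- **pull-backs preserve the balanced span** -/
theorem balSpan_map_le (f : Hom X Y) (k : ℕ) :
    (Y.balSpan k).map (exteriorPower.map k (f.lin.baseChange ℂ)) ≤ X.balSpan k := by
  rw [balSpan, Submodule.map_span_le]
  rintro _ ⟨g, hg, rfl⟩
  refine (Submodule.span_le.mpr ?_) (map_mono_mem_span_tcnt f k g)
  rintro _ ⟨r, hr, rfl⟩
  exact X.mono_mem_balSpan fun T => by rw [hr T, hr Tᶜ, hg T]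

/-- **pull-backs preserve the unbalanced span** -/
theorem unbSpan_map_le (f : Hom X Y) (k : ℕ) :
    (Y.unbSpan k).map (exteriorPower.map k (f.lin.baseChange ℂ)) ≤ X.unbSpan k := by
  rw [unbSpan, Submodule.map_span_le]
  rintro _ ⟨g, hg, rfl⟩
  refine (Submodule.span_le.mpr ?_) (map_mono_mem_span_tcnt f k g)
  rintro _ ⟨r, hr, rfl⟩
  refine X.mono_mem_unbSpan fun h => hg fun T => ?_
  rw [← hr T, ← hr Tᶜ, h T]

/-! ### CM objects: conjugation and the full index set -/

variable (X)

/-- if conjugation `s ↦ s̄` complements Galois types, it carries the indices of type `T` in `S` onto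
those of type `Tᶜ` in `S̄` -/
lemma fcnt_map_bar (h : ∀ s : X.Idx, X.typ (X.bar s) = (X.typ s)ᶜ) (S : Finset X.Idx) (T : Set Gam) :
    X.fcnt (S.map X.barEmb) Tᶜ = X.fcnt S T := by
  classical
  rw [fcnt_eq_card_filter, fcnt_eq_card_filter,
    ← Finset.card_image_of_injective (S.filter fun s => X.typ s = T) X.barEmb.injective]
  congr 1
  ext s
  simp only [Finset.mem_filter, Finset.mem_map, Finset.mem_image]
  constructor
  · rintro ⟨⟨t, ht, rfl⟩, hT⟩
    refine ⟨t, ⟨ht, ?_⟩, rfl⟩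
    have h' := h t
    change X.typ (X.bar t) = Tᶜ at hT
    rw [hT, compl_inj_iff] at h'
    exact h'.symm
  · rintro ⟨t, ⟨ht, hT⟩, rfl⟩
    refine ⟨⟨t, ht, rfl⟩, ?_⟩
    change X.typ (X.bar t) = Tᶜ
    rw [h t, hT]

/-- conjugation preserves balancedness (CM atoms) -/
theorem balS_map_bar (h : ∀ s : X.Idx, X.typ (X.bar s) = (X.typ s)ᶜ) {S : Finset X.Idx} (hS : X.BalS S) :
    X.BalS (S.map X.barEmb) := fun T => by
  rw [← compl_compl T, fcnt_map_bar X h, compl_compl, fcnt_map_bar X h, hS Tᶜ, compl_compl]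

/-- **the full index set of a CM object is balanced** (pair `s ↔ s̄`) -/
theorem balS_univ (h : ∀ s : X.Idx, X.typ (X.bar s) = (X.typ s)ᶜ) : X.BalS Finset.univ := fun T => by
  have h1 := X.fcnt_map_bar h Finset.univ T
  rw [Finset.map_univ_of_surjective (fun s => ⟨X.bar s, X.bar_bar s⟩)] at h1
  rw [← h1]

/-- type counts of a set and of its complement add up to those of the full index set -/
lemma fcnt_add_fcnt_compl (S : Finset X.Idx) (T : Set Gam) :
    X.fcnt S T + X.fcnt Sᶜ T = X.fcnt Finset.univ T := by
  haveI : DecidablePred fun s : X.Idx => X.typ s = T := fun _ => Classical.propDecidable _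
  rw [fcnt_eq_card_filter, fcnt_eq_card_filter, fcnt_eq_card_filter]
  have e1 : (S.filter fun s => X.typ s = T) = (Finset.univ.filter fun s => X.typ s = T).filter fun s => s ∈ S := by
    ext s; simp only [Finset.mem_filter, Finset.mem_univ, true_and]; tauto
  have e2 : (Sᶜ.filter fun s => X.typ s = T) = (Finset.univ.filter fun s => X.typ s = T).filter fun s => ¬ s ∈ S := by
    ext s; simp only [Finset.mem_filter, Finset.mem_univ, true_and, Finset.mem_compl]; tauto
  rw [e1, e2, Finset.card_filter_add_card_filter_not]

/-- complements of balanced sets are balanced, when the full set is -/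
theorem balS_compl {S : Finset X.Idx} (hS : X.BalS S) (hu : X.BalS Finset.univ) : X.BalS Sᶜ := fun T => by
  have h1 := X.fcnt_add_fcnt_compl S T
  have h2 := X.fcnt_add_fcnt_compl S Tᶜ
  rw [hS T, hu T] at h1
  omega

end Obj

end HodgeCM.Toy

end
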